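import Summits.ResolutionOfSingularities.ResolutionOfSingularities.Theorems.MarkedTransferCampaignW46WWalkThread
import Summits.ResolutionOfSingularities.ResolutionOfSingularities.Theorems.MarkedTransferCampaignW46MohWindowShadeFormalNRStepPrep
import HarnessLib

/-!
# [OURS · L1 W4.6 rung (iii-2), NON-RATIONAL W-WALK, brick 2] The regime at a thread point read through a `w`-anchor over ANY
# coefficient field: window facts, boundary exponents, the DEFECT LAW, and `f₀ ≡ u·c_z^p`

Cell `res-hironaka`, LADDER-RESOLUTION rung L (D-0089), slot W4.6 rung (iii); seat res-L1-s46-pv-6 (gen 8). Host route MarkedTransfer,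
`--supports stmt-ResolutionOfSingularities-16155 --as helper`; kind proof (no definition). res-L1-s46-pv-5's `…WWalkThread.residual_facts`
and `bdiv_lt_of_wAnchor` tie the coefficient field of the anchor `e : 𝒪̂ ≃+* K⟦t,y,z⟧` to the GROUND field `K`; along a thread through
NON-rational points the anchors live over the residue fields `K₀` of the points. This file re-reads the same facts for an anchor over an
arbitrary field `K₀` of characteristic `p` (proofs verbatim: pv-5's ring-level lemmas `window_and_ndz_of_wAnchor` and the door
`exists_forall_not_map_le_span_pair_pow_sup_mvPowerSeries` are already field-agnostic), and adds:
* `coeff_eq_zero_of_not_ndz` — THE DEFECT LAW: if the residual `f` of order `d` has NO `z`-free monomial of degree `d`, then `d` is below the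
  residual order of the point and EVERY degree-`d` monomial of `f` has `z`-exponent `≥ p` (o1's coefficient window presentation);
* `exists_unit_sub_mul_pow_mem_of_lowVanish` — `f₀ ≡ u · c_z^p (mod 𝔪^{p+1})` for a `w`-anchor with `ord f ≥ p + 1` (gen 7's
  `exists_unit_sub_mul_pow_mem` for a general three-variable residual).

HONEST FRAMING. OURS; nothing here is a statement of H. Hironaka's manuscript [Hironaka2017] and nothing of it is used. AI-written;
AI review is weaker than expert review. No `sorry`; axioms standard. [cite: Matsumura1987, Thm. 8.11] (completion is faithfully flat);
[cite: StacksProject, Tag 00DV] (Nakayama, inside pv-5's door); [folklore].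
-/

noncomputable section

set_option linter.dupNamespace false -- mandated namespace of this single-conjunct summit

open MvPowerSeries IsLocalRing Finset
open Literature.AlgebraicGeometry.Resolution
open Literature.RingTheory.MvPowerSeries.Jets (mem_maximalIdeal_iff_constantCoeff_eq_zero mem_maximalIdeal_pow_iff)

namespace Summit.ResolutionOfSingularities.ResolutionOfSingularities.Theorems

namespace CampaignW46

namespace WWalkNR

open CategoryTheory AlgebraicGeometry TopologicalSpace
open Literature.AlgebraicGeometry.Hironaka2017.S02Preliminaries
open Literature.AlgebraicGeometry.Hironaka2017.Datum
open Scheme.IdealSheafData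
open WWalk
open CampaignW46.FormalChart (ringEquiv_mem_maximalIdeal ringEquiv_mem_maximalIdeal_pow)
open CampaignW46.AtomGerm (mem_maximalIdeal_pow_iff_algebraMap)

/-! ## §1 Window facts and boundary exponents, any coefficient field -/

section Facts

variable {p : ℕ} [hp : Fact p.Prime] {K : Type} [Field K] [CharP K p] {K₀ : Type} [Field K₀] [CharP K₀ p]

/-- The residual of a `w`-anchor OVER ANY COEFFICIENT FIELD `K₀` at a point of the regime: `f ≠ 0`, `p + 1 ≤ ord f ≤ 2p − 1` (as a natural
number `d`), `LowVanish d f`, a monomial of degree `d`, and (ND) when the shade is `< p` (pv-5's `residual_facts`, coefficient field decoupled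
from the ground field). [cite: Matsumura1987, Thm. 8.11] -/
theorem residual_facts {A : AmbientDatum p K} {E : IdealExponent A.Z} (hRg : regimeMohWindowSurfaceInsep (p := p) (K := K) A E)
    {ξ : A.Z} (hξ : ξ ∈ E.sing)
    (e : AdicCompletion (maximalIdeal (A.Z.presheaf.stalk ξ)) (A.Z.presheaf.stalk ξ) ≃+* MvPowerSeries (Option (Fin 2)) K₀)
    {f₀ : A.Z.presheaf.stalk ξ} (hJ : stalkIdeal E.J ξ = Ideal.span {f₀}) {w : MvPowerSeries (Option (Fin 2)) K₀} (hw : IsUnit w)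
    {f : MvPowerSeries (Option (Fin 2)) K₀} (hE : e (algebraMap _ _ f₀) = w * (X none ^ p + f)) (hfP2 : LowVanish (p + 1) f)
    {rt ry : ℕ} (hB : BDiv rt ry f) :
    ∃ d : ℕ, f.order = d ∧ p + 1 ≤ d ∧ d ≤ 2 * p - 1 ∧ LowVanish d f ∧ (∃ a b c, a + b + c = d ∧ coeff (mk3 a b c) f ≠ 0) ∧
      (d - rt - ry < p → NDz d f) := by
  classical
  obtain ⟨hR, -, -, -, -⟩ := MohWindowShadeAnchorWalk.regime_point hRg hξ
  haveI := hR
  haveI : IsDomain (A.Z.presheaf.stalk ξ) := isDomain_of_isRegularLocalRing _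
  obtain ⟨d₂, hd₂, hd₂', hvan, a₀, b₀, hab₀, hne₀⟩ := window_and_ndz_of_wAnchor (coeffAt_of_regime hRg hξ) e hJ hw hE hfP2
  have hle : f.order ≤ d₂ := by
    have := MvPowerSeries.order_le (f := f) hne₀
    rwa [degree_mk3, hab₀] at this
  have hge : ((p + 1 : ℕ) : ℕ∞) ≤ f.order := MvPowerSeries.nat_le_order fun e he => hfP2 e (by exact_mod_cast he)
  obtain ⟨d, hd⟩ : ∃ d : ℕ, f.order = d := by
    have : f.order ≠ ⊤ := by
      intro h; rw [h] at hle; exact absurd hle (by simp)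
    exact ENat.ne_top_iff_exists.mp this |>.imp fun d h => h.symm
  have hpd : p + 1 ≤ d := by rw [hd] at hge; exact_mod_cast hge
  have hdd₂ : d ≤ d₂ := by rw [hd] at hle; exact_mod_cast hle
  have hlow : LowVanish d f := fun e he => MvPowerSeries.coeff_of_lt_order (by rw [hd]; exact_mod_cast he)
  have hex : ∃ a b c, a + b + c = d ∧ coeff (mk3 a b c) f ≠ 0 := by
    obtain ⟨⟨e', he', hdeg⟩, -⟩ := (MvPowerSeries.order_eq_nat (f := f) (n := d)).mp hd
    refine ⟨e' (some 0), e' (some 1), e' none, by rw [← degree_eq]; exact hdeg, by rw [mk3_eta]; exact he'⟩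
  refine ⟨d, hd, hpd, by omega, hlow, hex, fun hσ => ?_⟩
  obtain ⟨a, b, c, habc, hne⟩ := hex
  have hbd := hB _ hne
  simp only [mk3_t, mk3_y] at hbd
  have hcp : c < p := by omega
  have hdeq : d = d₂ := by
    by_contra hne'
    exact hne (hvan a b c (by omega) hcp)
  rw [hdeq]
  exact ⟨a₀, b₀, hab₀, hne₀⟩

/-- **THE DEFECT LAW.** If the residual `f` of a `w`-anchor (any coefficient field) at a point of o1's regime has order `d` but NO `z`-free
monomial of degree `d`, then `d` lies strictly below the residual order of the point and every degree-`d` monomial of `f` has `z`-exponent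
`≥ p` (all monomials of `z`-exponent `< p` below the residual order vanish, `…WWalkPoint.window_and_ndz_of_wAnchor`).
[cite: Matsumura1987, Thm. 8.11] -/
theorem coeff_eq_zero_of_not_ndz {A : AmbientDatum p K} {E : IdealExponent A.Z} (hRg : regimeMohWindowSurfaceInsep (p := p) (K := K) A E)
    {ξ : A.Z} (hξ : ξ ∈ E.sing)
    (e : AdicCompletion (maximalIdeal (A.Z.presheaf.stalk ξ)) (A.Z.presheaf.stalk ξ) ≃+* MvPowerSeries (Option (Fin 2)) K₀)
    {f₀ : A.Z.presheaf.stalk ξ} (hJ : stalkIdeal E.J ξ = Ideal.span {f₀}) {w : MvPowerSeries (Option (Fin 2)) K₀} (hw : IsUnit w)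
    {f : MvPowerSeries (Option (Fin 2)) K₀} (hE : e (algebraMap _ _ f₀) = w * (X none ^ p + f)) (hfP2 : LowVanish (p + 1) f)
    {d : ℕ} (hd : f.order = d) (hnd : ¬ NDz d f) {a b c : ℕ} (habc : a + b + c = d) (hc : c < p) : coeff (mk3 a b c) f = 0 := by
  classical
  obtain ⟨hR, -, -, -, -⟩ := MohWindowShadeAnchorWalk.regime_point hRg hξ
  haveI := hR
  haveI : IsDomain (A.Z.presheaf.stalk ξ) := isDomain_of_isRegularLocalRing _
  obtain ⟨d₂, -, -, hvan, a₀, b₀, hab₀, hne₀⟩ := window_and_ndz_of_wAnchor (coeffAt_of_regime hRg hξ) e hJ hw hE hfP2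
  have hle : f.order ≤ d₂ := by
    have := MvPowerSeries.order_le (f := f) hne₀
    rwa [degree_mk3, hab₀] at this
  have hdd₂ : d ≤ d₂ := by rw [hd] at hle; exact_mod_cast hle
  have hlt : d < d₂ := by
    refine lt_of_le_of_ne hdd₂ fun heq => hnd ?_
    rw [heq]
    exact ⟨a₀, b₀, hab₀, hne₀⟩
  exact hvan a b c (by omega) hc

variable [PerfectField K]

omit [CharP K₀ p] in
/-- The boundary exponents of a `w`-anchor over any coefficient field are `< p` (pv-5's `bdiv_lt_of_wAnchor`: the approximate exit door in
the completion, which allows any coefficient field). [cite: StacksProject, Tag 00DV] -/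
theorem bdiv_lt_of_wAnchor {A : AmbientDatum p K} {E : IdealExponent A.Z} (hRg : regimeMohWindowSurfaceInsep (p := p) (K := K) A E)
    {ξ : A.Z} (e : AdicCompletion (maximalIdeal (A.Z.presheaf.stalk ξ)) (A.Z.presheaf.stalk ξ) ≃+* MvPowerSeries (Option (Fin 2)) K₀)
    {f₀ : A.Z.presheaf.stalk ξ} (hJ : stalkIdeal E.J ξ = Ideal.span {f₀}) {w : MvPowerSeries (Option (Fin 2)) K₀}
    {f : MvPowerSeries (Option (Fin 2)) K₀} (hE : e (algebraMap _ _ f₀) = w * (X none ^ p + f)) {rt ry : ℕ} (hB : BDiv rt ry f) :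
    rt < p ∧ ry < p := by
  classical
  obtain ⟨⟨⟨-, hcl⟩, -⟩, hb⟩ := (regimeMohWindowSurfaceInsep_iff A E).mp hRg
  obtain ⟨N, hN⟩ := exists_forall_not_map_le_span_pair_pow_sup_mvPowerSeries A E hcl (by rw [hb]; exact hp.out.pos) ξ e
  rw [hb] at hN
  have hmap : (stalkIdeal E.J ξ).map ((e : AdicCompletion (maximalIdeal (A.Z.presheaf.stalk ξ)) (A.Z.presheaf.stalk ξ) →+*
      MvPowerSeries (Option (Fin 2)) K₀).comp (algebraMap (A.Z.presheaf.stalk ξ) (AdicCompletion (maximalIdeal (A.Z.presheaf.stalk ξ)) (A.Z.presheaf.stalk ξ)))) =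
      Ideal.span {w * (X none ^ p + f)} := by
    rw [hJ, Ideal.map_span, Set.image_singleton, RingHom.comp_apply]
    change Ideal.span {e (algebraMap _ _ f₀)} = _
    rw [hE]
  have key : ∀ i : Option (Fin 2), i ≠ none → (∀ e', coeff e' f ≠ 0 → p ≤ e' i) → False := by
    intro i hi hdiv
    apply hN (X none) (X i) (mem_maximalIdeal_iff_constantCoeff_eq_zero.mpr (constantCoeff_X _))
      (mem_maximalIdeal_iff_constantCoeff_eq_zero.mpr (constantCoeff_X _))
    rw [hmap, Ideal.span_singleton_le_iff_mem]
    refine Ideal.mem_sup_left (Ideal.mul_mem_left _ _ (Ideal.add_mem _ ?_ ?_))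
    · exact Ideal.pow_mem_pow (Ideal.subset_span (Set.mem_insert _ _)) p
    · have hdvd : (X i : MvPowerSeries (Option (Fin 2)) K₀) ^ p ∣ f :=
        (MvPowerSeries.X_pow_dvd_iff).mpr fun m hm => by by_contra h; exact absurd (hdiv m h) (by omega)
      obtain ⟨q, hq⟩ := hdvd
      rw [hq]
      exact Ideal.mul_mem_right _ _ (Ideal.pow_mem_pow (Ideal.subset_span (Set.mem_insert_of_mem _ (Set.mem_singleton _))) p)
  constructor
  · by_contra h
    push Not at h
    exact key (some 0) (Option.some_ne_none 0) fun e' he' => h.trans (hB e' he').1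
  · by_contra h
    push Not at h
    exact key (some 1) (Option.some_ne_none 1) fun e' he' => h.trans (hB e' he').2

omit [CharP K₀ p] in
/-- **The door in the completion, any coefficient field** (pv-5's `exists_forall_not_map_le_span_pair_pow_sup_mvPowerSeries` read on the
generator of a `w`-anchor): there is `N₀` with `z^p + f ∉ (u, v)^p + 𝔪^{N₀}` for all `u, v ∈ 𝔪`. [cite: StacksProject, Tag 00DV] -/
theorem exists_door_of_wAnchor {A : AmbientDatum p K} {E : IdealExponent A.Z} (hRg : regimeMohWindowSurfaceInsep (p := p) (K := K) A E)
    {ξ : A.Z} (e : AdicCompletion (maximalIdeal (A.Z.presheaf.stalk ξ)) (A.Z.presheaf.stalk ξ) ≃+* MvPowerSeries (Option (Fin 2)) K₀)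
    {f₀ : A.Z.presheaf.stalk ξ} (hJ : stalkIdeal E.J ξ = Ideal.span {f₀}) {w : MvPowerSeries (Option (Fin 2)) K₀}
    {f : MvPowerSeries (Option (Fin 2)) K₀} (hE : e (algebraMap _ _ f₀) = w * (X none ^ p + f)) :
    ∃ N₀, ∀ u v : MvPowerSeries (Option (Fin 2)) K₀, u ∈ maximalIdeal (MvPowerSeries (Option (Fin 2)) K₀) →
      v ∈ maximalIdeal (MvPowerSeries (Option (Fin 2)) K₀) →
      X none ^ p + f ∉ Ideal.span {u, v} ^ p ⊔ maximalIdeal (MvPowerSeries (Option (Fin 2)) K₀) ^ N₀ := by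
  classical
  obtain ⟨⟨⟨-, hcl⟩, -⟩, hb⟩ := (regimeMohWindowSurfaceInsep_iff A E).mp hRg
  obtain ⟨N₀, hN₀⟩ := exists_forall_not_map_le_span_pair_pow_sup_mvPowerSeries A E hcl (by rw [hb]; exact hp.out.pos) ξ e
  rw [hb] at hN₀
  refine ⟨N₀, fun u v hu hv hmem => hN₀ u v hu hv ?_⟩
  rw [hJ, Ideal.map_span, Set.image_singleton, RingHom.comp_apply]
  change Ideal.span {e (algebraMap _ _ f₀)} ≤ _
  rw [hE, Ideal.span_singleton_le_iff_mem]
  exact Ideal.mul_mem_left _ _ hmem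

end Facts

/-! ## §2 `f₀ ≡ u·c_z^p (mod 𝔪^{p+1})` for a `w`-anchor -/

section Congruence

variable {p : ℕ} [hp : Fact p.Prime] {K₀ : Type} [Field K₀] [CharP K₀ p]
  {R : Type} [CommRing R] [IsLocalRing R] [IsNoetherianRing R]
  (E₀ : AdicCompletion (maximalIdeal R) R ≃+* MvPowerSeries (Option (Fin 2)) K₀)
  (c : Option (Fin 2) → R)
  (hcX : ∀ j, E₀ (algebraMap R (AdicCompletion (maximalIdeal R) R) (c j)) - MvPowerSeries.X j ∈
    maximalIdeal (MvPowerSeries (Option (Fin 2)) K₀) ^ 2)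

include hcX in
/-- **`f₀ ≡ u · c_z^p (mod 𝔪_R^{p+1})` for a unit `u`** when `E₀(f₀) = w · (z^p + f)` with `ord f ≥ p + 1` (`f ∈ K₀⟦t,y,z⟧` arbitrary): the
residual and the correction `(E₀ c_z − X_z)^p` lie in `𝔪̂^{p+1}`, and the unit `E₀⁻¹ w` is approximated from `R`. [cite: Matsumura1987, Thm. 8.11] -/
theorem exists_unit_sub_mul_pow_mem_of_lowVanish (f₀ : R) (w₀ : MvPowerSeries (Option (Fin 2)) K₀) (hw₀ : IsUnit w₀)
    (f : MvPowerSeries (Option (Fin 2)) K₀) (hf : LowVanish (p + 1) f)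
    (hf₀ : E₀ (algebraMap R (AdicCompletion (maximalIdeal R) R) f₀) = w₀ * (MvPowerSeries.X none ^ p + f)) :
    ∃ u : R, IsUnit u ∧ f₀ - u * c none ^ p ∈ maximalIdeal R ^ (p + 1) := by
  set ofR := algebraMap R (AdicCompletion (maximalIdeal R) R) with hofR
  haveI : CharP (MvPowerSeries (Option (Fin 2)) K₀) p :=
    charP_of_injective_algebraMap (algebraMap K₀ (MvPowerSeries (Option (Fin 2)) K₀)).injective p
  haveI : IsNoetherianRing (AdicCompletion (maximalIdeal R) R) := isNoetherianRing_adicCompletion_maximalIdeal R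
  set δ := E₀ (ofR (c none)) - MvPowerSeries.X none with hδ
  have hδp : δ ^ p ∈ maximalIdeal (MvPowerSeries (Option (Fin 2)) K₀) ^ (p + 1) := by
    have h1 : δ ^ p ∈ maximalIdeal (MvPowerSeries (Option (Fin 2)) K₀) ^ (2 * p) := by rw [pow_mul]; exact Ideal.pow_mem_pow (hcX none) p
    exact Ideal.pow_le_pow_right (by have := hp.out.two_le; omega) h1
  have hcp : E₀ (ofR (c none ^ p)) = MvPowerSeries.X none ^ p + δ ^ p := by
    rw [map_pow, map_pow, show E₀ (ofR (c none)) = MvPowerSeries.X none + δ by rw [hδ]; ring, add_pow_char]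
  have hFm : f ∈ maximalIdeal (MvPowerSeries (Option (Fin 2)) K₀) ^ (p + 1) := mem_maximalIdeal_pow_iff.mpr hf
  obtain ⟨ubar, hubar⟩ := (AdicCompletion.residueField_map_bijective R).2 (residue _ (E₀.symm w₀))
  obtain ⟨u, rfl⟩ := residue_surjective ubar
  rw [ResidueField.map_residue] at hubar
  have hu𝔪 : ofR u - E₀.symm w₀ ∈ maximalIdeal _ := by rw [← Ideal.Quotient.eq]; exact hubar
  have hunit : IsUnit (E₀.symm w₀) := hw₀.map E₀.symm
  have hu : IsUnit u := by
    by_contra hnu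
    have h1 : ofR u ∈ maximalIdeal (AdicCompletion (maximalIdeal R) R) := by
      have := (mem_maximalIdeal_pow_iff_algebraMap 1 u).mp (by rw [pow_one]; exact (mem_maximalIdeal _).mpr hnu)
      rwa [pow_one] at this
    have h2 : E₀.symm w₀ ∈ maximalIdeal _ := by
      have := Ideal.sub_mem _ h1 hu𝔪; rwa [sub_sub_cancel] at this
    exact (mem_maximalIdeal _).mp h2 hunit
  refine ⟨u, hu, ?_⟩
  have hwu : w₀ - E₀ (ofR u) ∈ maximalIdeal (MvPowerSeries (Option (Fin 2)) K₀) := by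
    have := ringEquiv_mem_maximalIdeal E₀ hu𝔪
    rw [map_sub, RingEquiv.apply_symm_apply] at this
    rw [← Ideal.neg_mem_iff, neg_sub]; exact this
  have hXp : (MvPowerSeries.X none : MvPowerSeries (Option (Fin 2)) K₀) ^ p ∈ maximalIdeal (MvPowerSeries (Option (Fin 2)) K₀) ^ p :=
    Ideal.pow_mem_pow (mem_maximalIdeal_iff_constantCoeff_eq_zero.mpr (MvPowerSeries.constantCoeff_X _)) p
  have hmem : E₀ (ofR (f₀ - u * c none ^ p)) ∈ maximalIdeal (MvPowerSeries (Option (Fin 2)) K₀) ^ (p + 1) := by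
    have e1 : E₀ (ofR (f₀ - u * c none ^ p)) = (w₀ - E₀ (ofR u)) * MvPowerSeries.X none ^ p + w₀ * f - E₀ (ofR u) * δ ^ p := by
      rw [map_sub, map_mul, map_sub, map_mul, hf₀, hcp]; ring
    rw [e1]
    refine Ideal.sub_mem _ (Ideal.add_mem _ ?_ (Ideal.mul_mem_left _ _ hFm)) (Ideal.mul_mem_left _ _ hδp)
    rw [pow_succ']
    exact Ideal.mul_mem_mul hwu hXp
  exact (mem_maximalIdeal_pow_iff_algebraMap (p + 1) _).mpr (by
    have := ringEquiv_mem_maximalIdeal_pow E₀.symm hmem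
    rwa [RingEquiv.symm_apply_apply] at this)

end Congruence

end WWalkNR

end CampaignW46

end Summit.ResolutionOfSingularities.ResolutionOfSingularities.Theorems

end
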